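import Summits.CriticalPhenomena.PercolationContinuityZ3.Theses.PercNearOneGluing
import Summits.CriticalPhenomena.PercolationContinuityZ3.Theorems.PercNearOneGluingAdditiveGluingGoodStepResidual
import Summits.CriticalPhenomena.PercolationContinuityZ3.Theorems.PercNearOneGluingAdditiveGluingGoodStep
import Summits.CriticalPhenomena.PercolationContinuityZ3.Theorems.PercNearOneGluingAdditiveGluingGoodBase
import Summits.CriticalPhenomena.PercolationContinuityZ3.Theorems.PercNearOneGluingAdditiveGluingLemma5AnyRelay
import HarnessLib

/-!
# Pair-step BHK TOOLS for the crux `AdditiveGluing` (stmt-CriticalPhenomena-4576) — typed, sorried statements for stub-workers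
(control-strategist seat, generation 3, 2026-08-17; CONTROL-CENSUS.md §Generation 3, C17–C19, and the gain identity)

These four statements are NOT a line (the BHK-split line is dead: its residual `S2q` is false, CONTROL-CENSUS C20).  They are true
(0 violations in every exact test incl. exhaustive n = 5 at three p and a 1/8 sample of n = 6, every designation — CONTROL-CENSUS §CERTIFICATION), designation-free, and provable now from the vendored BHK 2006 facts
plus the tree's pocket decoupling (`…OffObserverFibres`, `…BlockPockets`); each is M-sized.  `tool_hijackBHK` gives the one-relay inequality
`Z(s)·Hij ≤ WIN(s)·(Z(s) − Z(S))` at any number of relays (the `cls_win ≥ 0` part of the pair step's budget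
`K(S)Z(s) − K(s)Z(S) = K(s)(Z(s)−Z(S)) + Z(s)(E₁ + IHV − Hij)`); `tool_gainIdentity` is the bookkeeping identity every route through the pair step uses.
Land them `--supports stmt-CriticalPhenomena-4576` under Theorems/ (names free).
-/

namespace Summit.CriticalPhenomena.PercolationContinuityZ3.Cruxes.AdditiveGluing.PairStepBHKTools

open MeasureTheory Set
open Literature.Probability.LatticeModels (prodBernoulli)
open Literature.Probability.Percolation (BondConfig openConn openConnIn openGraph openCluster)
open Summit.CriticalPhenomena.PercolationContinuityZ3.Theorems
open scoped BigOperators Classical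

noncomputable section

/-- **N2 (provable now, pure BHK, any designation): `Z(s)·Hij ≤ WIN(s)·Zx(s)`** — the one-relay inequality `Z·Hij ≤ WIN·(Z(s)−Z(S))` at ANY number
of relays follows (`Z(s) − Z(S) ≥ Zx(s)` elementarily: a pocket survives the gluing of `x` only if `x ↮ a₀` off it).
Proof sketch: `N = {s ↮ a₀}`; BHK 2006 Thm 1.4 (`1{b ∈ C_s}` vs `1{x ∈ C_{a₀}}` given N), then Thm 1.3 for `C_s` given `s ↮ a₀` applied to the two
ANTITONE functions `ρ(C) = 1{V(C) ∩ A = ∅}·min_A μ(a ↔ b off V(C))`, `η(C) = μ(x ↔ a₀ off V(C))` (`:= 0` if `x ∈ V(C)`):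
`(∫_N ρ)(∫_N η) ≤ μ(N)·∫_N ρη`, and the pocket decoupling `μ(C(s)=W ∩ E) = μ(C(s)=W)·μ(E in Wᶜ)`.  0 violations (≈ 380 000 exact instances incl. the exhaustive sweep).
[cite: VandenbergHaggstromKahn2005, Thm. 1.3 (p. 6), Thm. 1.4 (p. 7); KozmaNitzan2024, Lemma 1 (pp. 5–6)] -/
theorem tool_hijackBHK :
    ∀ (n : ℕ) (u : Sym2 (Fin n) → unitInterval) (A : Finset (Fin n)) (b a₀ s x : Fin n) (hb : b ∈ A),
      a₀ ∈ A → s ∉ A → x ∉ A → s ≠ x →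
      (∑ W ∈ (Finset.univ : Finset (Finset (Fin n))).filter (fun W => s ∈ W ∧ Disjoint W A),
              (prodBernoulli u).real {ω : BondConfig (Fin n) | openCluster ω s = (W : Set (Fin n))}
                * A.inf' ⟨b, hb⟩ (fun a => (prodBernoulli u).real (openConnIn ((W : Set (Fin n))ᶜ) a b)))
        * (prodBernoulli u).real (openConn s b ∩ (openConn a₀ s)ᶜ ∩ openConn x a₀)
      ≤ (prodBernoulli u).real (openConn s b ∩ (openConn a₀ s)ᶜ)
        * (∑ W ∈ (Finset.univ : Finset (Finset (Fin n))).filter (fun W => s ∈ W ∧ Disjoint W A),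
              (prodBernoulli u).real {ω : BondConfig (Fin n) | openCluster ω s = (W : Set (Fin n))}
                * A.inf' ⟨b, hb⟩ (fun a => (prodBernoulli u).real (openConnIn ((W : Set (Fin n))ᶜ) a b))
                * (prodBernoulli u).real (openConnIn ((W : Set (Fin n))ᶜ) x a₀)) := by
  sorry

/-- **N2q (provable now, pure BHK 1.3 given `s ↮ {a₀, x}`): the split hijack bound.**
`Z_{x∉}(s) · Hij ≤ WIN_{x∉}(s) · Zx(s)`: the dead-pocket mass of `s` over pockets NOT containing `x` times the hijack mass
`μ(s↔b, a₀↮s, x↔a₀)` is at most `μ(s↔b, a₀↮s, s↮x)` times the pocket mass re-weighted by `μ(x ↔ a₀ in Wᶜ)`.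
Proof sketch (control-strategist g3): with `N₂ = {s ↮ a₀} ∩ {s ↮ x}`, BHK 2006 Thm 1.3 for the cluster of `s` given `s ↮ {a₀, x}`
twice — (i) `1{b ∈ C_s}` increasing vs `η(C_s) = μ(x ↔ a₀ off C_s)` antitone: `μ(N₂)·μ(win, x↔a₀) ≤ μ(win, s↮x)·∫_{N₂} η`;
(ii) the two antitone functions `ρ(C_s) = 1{C_s ∩ A = ∅}·min_A μ(a ↔ b off C_s)` and `η`: `(∫_{N₂} ρ)(∫_{N₂} η) ≤ μ(N₂)·∫_{N₂} ρη` —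
plus the pocket decoupling `μ(C(s) = W ∩ E) = μ(C(s) = W)·μ(E in Wᶜ)` for events `E` off `W`.  0 violations in ≈ 6 000 exact instances
(2–4 relays, n ≤ 8, every designation, glued blocks).
[cite: VandenbergHaggstromKahn2005, Thm. 1.3 (p. 6); KozmaNitzan2024, Lemma 1 (pp. 5–6), §3.2 pp. 12–14] -/
theorem tool_hijackSplitBHK :
    ∀ (n : ℕ) (u : Sym2 (Fin n) → unitInterval) (A : Finset (Fin n)) (b a₀ s x : Fin n) (hb : b ∈ A),
      a₀ ∈ A → s ∉ A → x ∉ A → s ≠ x →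
      (∑ W ∈ (Finset.univ : Finset (Finset (Fin n))).filter (fun W => (s ∈ W ∧ Disjoint W A) ∧ x ∉ W),
              (prodBernoulli u).real {ω : BondConfig (Fin n) | openCluster ω s = (W : Set (Fin n))}
                * A.inf' ⟨b, hb⟩ (fun a => (prodBernoulli u).real (openConnIn ((W : Set (Fin n))ᶜ) a b)))
        * (prodBernoulli u).real (openConn s b ∩ (openConn a₀ s)ᶜ ∩ openConn x a₀)
      ≤ (prodBernoulli u).real (openConn s b ∩ (openConn a₀ s)ᶜ ∩ (openConn s x)ᶜ)
        * (∑ W ∈ (Finset.univ : Finset (Finset (Fin n))).filter (fun W => (s ∈ W ∧ Disjoint W A) ∧ x ∉ W),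
              (prodBernoulli u).real {ω : BondConfig (Fin n) | openCluster ω s = (W : Set (Fin n))}
                * A.inf' ⟨b, hb⟩ (fun a => (prodBernoulli u).real (openConnIn ((W : Set (Fin n))ᶜ) a b))
                * (prodBernoulli u).real (openConnIn ((W : Set (Fin n))ᶜ) x a₀)) := by
  sorry

/-- **n1p (provable now, pure BHK, any designation): dead-conditioned winner attracts** —
`μ(s dead ∩ a₀↔b) · μ(s↔b ∩ a₀↮s ∩ x↔a₀) ≤ μ(s↔b ∩ a₀↮s) · μ(s dead ∩ a₀↔b ∩ x↔a₀)`, `s dead = ⋂_{a∈A} {s ↮ a}`.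
At one relay this is the landed `pairStep_winner_attracts`.  Proof sketch: Thm 1.4 as there, then Thm 1.3 for `C_{a₀}` given `a₀ ↮ s` with
`F(C) = 1{b ∈ V(C)}·φ(C)`, `φ(C) = μ(s ↮ A∖V(C) off V(C))` (INCREASING in `C`) and `G(C) = 1{x ∈ V(C)}`.  0 violations (incl. the exhaustive sweep).
[cite: VandenbergHaggstromKahn2005, Thm. 1.3 (p. 6), Thm. 1.4 (p. 7); KozmaNitzan2024, Lemma 1 (pp. 5–6)] -/
theorem tool_deadWinnerAttracts :
    ∀ (n : ℕ) (u : Sym2 (Fin n) → unitInterval) (A : Finset (Fin n)) (b a₀ s x : Fin n) (hb : b ∈ A),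
      a₀ ∈ A → s ∉ A → x ∉ A → s ≠ x →
      (prodBernoulli u).real ((⋂ a ∈ A, (openConn s a)ᶜ) ∩ openConn a₀ b)
        * (prodBernoulli u).real (openConn s b ∩ (openConn a₀ s)ᶜ ∩ openConn x a₀)
      ≤ (prodBernoulli u).real (openConn s b ∩ (openConn a₀ s)ᶜ)
        * (prodBernoulli u).real ((⋂ a ∈ A, (openConn s a)ᶜ) ∩ openConn a₀ b ∩ openConn x a₀) := by
  sorry

/-- **Gain identity of the pair step (bookkeeping, provable now).**
`μ(S↔b) − μ(s↔b) − μ(a₀↮b, a₀↔S, S↔b) = μ(s↮b, a₀↮s, x↔b) − μ(s↔b, a₀↮s, x↔a₀)` for `S = {s, x}`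
(both sides = gain of the block minus the hijack; two disjoint-union identities on the configuration space).
[cite: KozmaNitzan2024, §3.2 pp. 12–14] -/
theorem tool_gainIdentity :
    ∀ (n : ℕ) (u : Sym2 (Fin n) → unitInterval) (A : Finset (Fin n)) (b a₀ s x : Fin n) (hb : b ∈ A),
      a₀ ∈ A → s ∉ A → x ∉ A → s ≠ x →
      (prodBernoulli u).real (⋃ v ∈ ({s, x} : Finset (Fin n)), openConn v b)
        - (prodBernoulli u).real (openConn s b)
        - (prodBernoulli u).real
              ((openConn a₀ b)ᶜ ∩ (⋃ v ∈ ({s, x} : Finset (Fin n)), openConn a₀ v) ∩ (⋃ v ∈ ({s, x} : Finset (Fin n)), openConn v b))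
      = (prodBernoulli u).real ((openConn s b)ᶜ ∩ (openConn a₀ s)ᶜ ∩ openConn x b)
        - (prodBernoulli u).real (openConn s b ∩ (openConn a₀ s)ᶜ ∩ openConn x a₀) := by
  sorry

end

end Summit.CriticalPhenomena.PercolationContinuityZ3.Cruxes.AdditiveGluing.PairStepBHKTools
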